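import Summits.QuantumFields.YangMills.Theorems.BalabanUVNodesPortU8ImagesSandwich
import Summits.QuantumFields.YangMills.Theorems.BalabanUVNodesPortU8LocUnivDecayClause3
import Summits.QuantumFields.YangMills.Theorems.BalabanUVNodesPortU8LocUnivPackageClauses34

/-!
# Port piece U8 — THE METHOD OF IMAGES, FILE 5: ★★★ `portPieceLocalityU8_LocUniv_images` — THE SELECTOR-FREE U8 PACKAGE ON THE TRANSVERSE TABLE WITH **NO DISPLAYED TOKEN AT ALL**:
# (C1)ᵀ `Response9DAtLocUnivξ` for every colour ∧ (C2a)(C2b)ᵀ ∧ (E4a)ᵀ, inputs `McGuard F Mc` and `α₂ > 0` ONLY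

Cell `ym-nodeO-ideate` ∕ `ym-balaban-port`, porter `ymgap-nodeO-port-PTB-1` (gen 5).  JOIN-side helper for **stmt-QuantumFields-27238** (K0ᴬ), `--supports … --as helper`; answers
director-ym №509 (iii′)∕№512 (the U8-type supply of the K0ᴬ decay road from `recordHrLocξ`-objects, with no displayed hypothesis) — PORT-PLAN-v4 §5.
[I] = [Balaban1987RG1], [15] = [Balaban1985Variational], [B5] = [Balaban1984PropagatorsI], [B6] = [Balaban1984PropagatorsII].

WHAT IS PROVED (kernel, sorry-free).
§1 ★★★ `response9D_LocUniv_images` — ✓`response9D_LocUniv_of_tokens` with its second displayed input (Tok-cmpU-cap) REMOVED: the (R4ᴰ) row is ✓`rowR4D_LocUniv_images` (file 4c), whose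
   NEAR bonds are served by ✓`images_near_clauses` (file 4b) instead of a window cap; input (‴-LocUniv) only.
§2 ★★★ `portPieceLocalityU8_LocUniv_images` — the conclusion of ✓`portPieceLocalityU8_LocUniv` VERBATIM — (C1)ᵀ `Response9DAtLocUnivξ F θ a Mc k (recordK₀ F Mc k) α₂ C₉ δ₀` for every
   colour, (C2a)(C2b)ᵀ and (E4a)ᵀ for `recordEmbLocξ … Finset.univ` — from `McGuard F Mc` and `α₂ > 0` ALONE: (‴-LocUniv) is ✓`hL3_of_clauses34` ∘ ✓`h34_of_clause3` ∘ ✓`h3_recordHrLocξ_univ`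
   (g4 files 8–9, g5 clause files 3–4), (Tok-cmpU-cap) is bypassed by the method of images (g5 files Images 1–4c).

HONEST FRAMING.  This is the token-free version of ONE port piece (U8-type locality of the whole-torus LOCALIZED linear response at the record, finite tori, linear order, flat
background); it is NOT v11-G₄'s `PortPieceLocalityU8` about `recordHr` (that item, 27931, is CLOSED·IMPLICATION-ONLY·IN TOTO and unchanged), it does NOT close K0ᴬ 27238 (OPEN), NODE O 0∕1,
COUNT 8∕28 · K 1∕4 UNMOVED; finite `𝕋⁴_{L^K}` at fixed ε — NOT continuum ∕ OS ∕ Clay; **the Yang–Mills mass gap (Clay) is NOT proved by any of this.**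
-/

noncomputable section

open scoped BigOperators Matrix.Norms.L2Operator

namespace Summit.QuantumFields.YangMills.Theorems.PortU8

open Literature.MathematicalPhysics.QuantumFieldTheory.Balaban1983to89
open Literature.MathematicalPhysics.QuantumFieldTheory.Balaban1983to89.Node00
open Literature.MathematicalPhysics.QuantumFieldTheory.Balaban1983to89.T4Continuum (T4Family)
open Summit.QuantumFields.YangMills.Theorems.K0RecordFormatNames

variable (F : T4Family)

/-! ## §1  ★★★ `Response9D` for the whole-torus localized data from (‴-LocUniv) alone -/

/-- ★★★ **`Response9D` FOR THE WHOLE-TORUS LOCALIZED RESPONSE DATA FROM (‴-LocUniv) ALONE — no (Tok-cmpU-cap).**  For every `α₂ > 0` there are `C₉ ≥ 0`, `δ₀ > 0` such that for all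
`k`, `ε₂₉ > 0` and every colour `a`, the data `{ recordResponse9DataFromL … with Gk := fun n => recordGkLocWξ F θ k (K₀+n) Finset.univ a }` satisfies `B12FormatPlus.Response9D` in the
(4.4)-gauge of `recordDom44J … α₂` with window `recordRNat`, PROVIDED (‴-LocUniv) (displayed here; PROVED: ✓`hL3_of_clauses34` …).  Rows: (R1ᴰ) ✓`rowR1D_Loc_at`, (R3)(R5) ✓p796246,
(R4ᴰ) ✓`rowR4D_LocUniv_images` + ✓`images_near_clauses`. [cite: Balaban1985Variational, Prop. 9 p.309, (190) p.308; Balaban1987RG1, (1.21) p.264, (4.4)–(4.5) pp.281–282, (4.35) p.290; Balaban1984PropagatorsI, p.36 ll.20–23] -/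
theorem response9D_LocUniv_images (Mc : ℕ) (a₀ : ℝ) (hMc : McGuard F Mc)
    (hL3 : ∃ C₉' δ₉ : ℝ, 0 ≤ C₉' ∧ 0 < δ₉ ∧ ∀ (k n : ℕ) (ε₂₉ : ℝ), 0 < ε₂₉ → letI θ := thetaFill F a₀ ε₂₉; letI := θ.instVβ₁; letI := θ.instVβ₂; letI := θ.instιβ;
      ∀ (a : θ.ιβ) (μ : Fin (F.P (recordK₀ F Mc k + n)).d) (y : Site (F.P (recordK₀ F Mc k + n)) (k + 1)),
      letI Hr : PBond (F.P (recordK₀ F Mc k + n)) 0 → Fin 2 → Fin 2 → ℂ := fun b' => recordHrLocξ F θ k (recordK₀ F Mc k + n) Finset.univ a (μ, y) b';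
      ∀ b : PBond (F.P (recordK₀ F Mc k + n)) 0,
        ‖Hr b‖ ≤ C₉' * (F.P (recordK₀ F Mc k + n)).eta (k + 1) * Real.exp (-(δ₉ * (Site.tdist (coarsenTo (k + 1) b.src) y : ℝ))) ∧
        (∀ ν : Fin (F.P (recordK₀ F Mc k + n)).d, ‖Hr ⟨b.src.shift ν, b.dir⟩ - Hr b‖ ≤ C₉' * (F.P (recordK₀ F Mc k + n)).eta (k + 1) ^ 2 * Real.exp (-(δ₉ * (Site.tdist (coarsenTo (k + 1) b.src) y : ℝ)))) ∧
        ‖∑ ν : Fin (F.P (recordK₀ F Mc k + n)).d, (Hr ⟨b.src.shift ν, b.dir⟩ - (2 : ℂ) • Hr b + Hr ⟨b.src.unshift ν, b.dir⟩)‖ ≤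
          C₉' * (F.P (recordK₀ F Mc k + n)).eta (k + 1) ^ 3 * Real.exp (-(δ₉ * (Site.tdist (coarsenTo (k + 1) b.src) y : ℝ))) ∧
        ‖∑ ν : Fin (F.P (recordK₀ F Mc k + n)).d, ((Hr ⟨b.src, b.dir⟩ + Hr ⟨(b.src).shift b.dir, ν⟩ - Hr ⟨(b.src).shift ν, b.dir⟩ - Hr ⟨b.src, ν⟩) -
          (Hr ⟨b.src.unshift ν, b.dir⟩ + Hr ⟨(b.src.unshift ν).shift b.dir, ν⟩ - Hr ⟨(b.src.unshift ν).shift ν, b.dir⟩ - Hr ⟨b.src.unshift ν, ν⟩))‖ ≤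
          C₉' * (F.P (recordK₀ F Mc k + n)).eta (k + 1) ^ 3 * Real.exp (-(δ₉ * (Site.tdist (coarsenTo (k + 1) b.src) y : ℝ))))
    (α₂ : ℝ) (hα₂ : 0 < α₂) :
    ∃ C₉ δ₀ : ℝ, 0 ≤ C₉ ∧ 0 < δ₀ ∧ ∀ k : ℕ, ∀ ε₂₉ : ℝ, 0 < ε₂₉ → ∀ a : (thetaFill F a₀ ε₂₉).ιβ,
      B12FormatPlus.Response9D
        ({ recordResponse9DataFromL F (thetaFill F a₀ ε₂₉) a Mc k (recordK₀ F Mc k) with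
            Gk := fun n => recordGkLocWξ F (thetaFill F a₀ ε₂₉) k (recordK₀ F Mc k + n) Finset.univ a })
        (fun n => recordChartJ F Mc k (recordK₀ F Mc k + n)) (fun n => recordRNat F Mc k (recordK₀ F Mc k + n))
        (fun n X => recordDom44J F Mc k (recordK₀ F Mc k + n) X α₂) C₉ δ₀ := by
  obtain ⟨CL, δL, hCL0, hδL, hLall⟩ := hL3
  obtain ⟨δI, hδI, AI, hAI, hIall⟩ := Images.images_near_clauses F
  -- unified constants
  obtain ⟨C, hCdef⟩ : ∃ C : ℝ, C = max CL 1 := ⟨_, rfl⟩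
  have hC0 : 0 < C := hCdef ▸ lt_of_lt_of_le one_pos (le_max_right _ _)
  have hCL : CL ≤ C := hCdef ▸ le_max_left _ _
  -- the (R4ᴰ) row constants
  obtain ⟨r, hrdef⟩ : ∃ r : ℝ, r = min (δL / 8) δI := ⟨_, rfl⟩
  have hr0 : 0 < r := by rw [hrdef]; exact lt_min (by positivity) hδI
  obtain ⟨C₄, hC4def⟩ : ∃ C₄ : ℝ, C₄ = (2 * C * Real.exp (δL * (2 * Mc + 2)) + AI) *
    (2 * (2 * 1 + 2 * ‖LinearMap.toContinuousLinearMap (sl2Proj.restrictScalars ℝ)‖ + 1) * Real.exp (4 * r * Mc) / α₂) := ⟨_, rfl⟩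
  have hC4 : 0 ≤ C₄ := by rw [hC4def]; positivity
  obtain ⟨δ₄, hδ4def⟩ : ∃ δ₄ : ℝ, δ₄ = 2 * r := ⟨_, rfl⟩
  have hδ4 : 0 < δ₄ := by rw [hδ4def]; positivity
  -- ★ the global two-volume row (R4ᴰ) for the whole-torus localized data WITHOUT a cap (file 4c + file 4b)
  have hR4B : ∀ k : ℕ, ∀ ε₂₉ : ℝ, 0 < ε₂₉ → ∀ a : (thetaFill F a₀ ε₂₉).ιβ, ∀ (n : ℕ) (X : (recordDomSys F Mc k (recordK₀ F Mc k + n)).Dom),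
      X ∉ recordWrapCtr F Mc k (recordK₀ F Mc k + n) → ∀ (μ : Fin 4) (z : Fin 4 → ℤ), (∀ l, 2 * |z l| < (recordRNat F Mc k (recordK₀ F Mc k + n) : ℤ)) →
      gauge (recordDom44J F Mc k (recordK₀ F Mc k + n) X α₂) (B12FormatPlus.cutTo (recordCXJ F Mc k (recordK₀ F Mc k + n) X) fun i =>
        recordGkLocWξ F (thetaFill F a₀ ε₂₉) k (recordK₀ F Mc k + (n + 1)) Finset.univ a (recordE F k (recordK₀ F Mc k + (n + 1)) μ z) (recordJXJ F (recordK₀ F Mc k + n) i) -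
          recordGkLocWξ F (thetaFill F a₀ ε₂₉) k (recordK₀ F Mc k + n) Finset.univ a (recordE F k (recordK₀ F Mc k + n) μ z) i) ≤
        C₄ * Real.exp (-δ₄ * (recordRNat F Mc k (recordK₀ F Mc k + n) : ℝ) / 2) * Real.exp (-(δ₄ / 2) * (recordSiteGeom F Mc k (recordK₀ F Mc k + n)).distD (recordE F k (recordK₀ F Mc k + n) μ z) X) := by
    intro k ε₂₉ hε a n X hX μ z hz
    have h := rowR4D_LocUniv_images (F := F) a₀ ε₂₉ hMc (Nat.le_add_right _ n) a μ z hz hX hC0 hδL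
      (fun b => fourClauses_weaken F _ b hCL hC0.le le_rfl (Real.exp_pos _).le
        (hLall k n ε₂₉ hε a (recordE F k (recordK₀ F Mc k + n) μ z).1 (recordE F k (recordK₀ F Mc k + n) μ z).2 b))
      (fun b => fourClauses_weaken F _ b hCL hC0.le le_rfl (Real.exp_pos _).le
        (hLall k (n + 1) ε₂₉ hε a (recordE F k (recordK₀ F Mc k + n + 1) μ z).1 (recordE F k (recordK₀ F Mc k + n + 1) μ z).2 b))
      hδI.le hAI (hIall a₀ ε₂₉ Mc k (recordK₀ F Mc k + n) hMc (Nat.le_add_right _ n) a μ z) hα₂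
    refine h.trans (le_of_eq ?_)
    have e1 : Real.exp (-δ₄ * (recordRNat F Mc k (recordK₀ F Mc k + n) : ℝ) / 2) = Real.exp (-(min (δL / 8) δI) * recordRNat F Mc k (recordK₀ F Mc k + n)) := by
      rw [hδ4def, hrdef]; congr 1; ring
    have e2 : Real.exp (-(δ₄ / 2) * (recordSiteGeom F Mc k (recordK₀ F Mc k + n)).distD (recordE F k (recordK₀ F Mc k + n) μ z) X) =
        Real.exp (-(min (δL / 8) δI) * (recordSiteGeom F Mc k (recordK₀ F Mc k + n)).distD (recordE F k (recordK₀ F Mc k + n) μ z) X) := by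
      rw [hδ4def, hrdef]; congr 1; ring
    rw [e1, e2, hC4def, hrdef]
    ring
  set A : ℝ := 2 * (2 * CL + 2 * ‖LinearMap.toContinuousLinearMap (sl2Proj.restrictScalars ℝ)‖ * CL + 1) * Real.exp (4 * δL * Mc) / α₂ with hA
  have hA0 : 0 ≤ A := by rw [hA]; positivity
  refine ⟨max A C₄, min δL δ₄, le_max_of_le_left hA0, lt_min hδL hδ4, fun k ε₂₉ hε a => ?_⟩
  refine response9D_LocUniv_of_decayRows hMc (thetaFill F a₀ ε₂₉) a k (le_max_of_le_left hA0) (lt_min hδL hδ4).le ?_ ?_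
  · intro n X y
    obtain ⟨μ0, y0⟩ := y
    have hrow := rowR1D_Loc_at (F := F) hMc (Nat.le_add_right _ _) a₀ ε₂₉ Finset.univ a (μ0, y0) X hα₂ hCL0 hδL.le
      (fun b _ => hLall k n ε₂₉ hε a μ0 y0 b)
    refine hrow.trans ?_
    have hd0 : 0 ≤ (recordSiteGeom F Mc k (recordK₀ F Mc k + n)).distD (μ0, y0) X := (recordSiteGeom F Mc k (recordK₀ F Mc k + n)).distD_nonneg (μ0, y0) X
    have hexp : Real.exp (-δL * (recordSiteGeom F Mc k (recordK₀ F Mc k + n)).distD (μ0, y0) X) ≤ Real.exp (-(min δL δ₄) * (recordSiteGeom F Mc k (recordK₀ F Mc k + n)).distD (μ0, y0) X) :=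
      Real.exp_le_exp.2 (by nlinarith [min_le_left δL δ₄])
    calc A * Real.exp (-δL * (recordSiteGeom F Mc k (recordK₀ F Mc k + n)).distD (μ0, y0) X)
        ≤ max A C₄ * Real.exp (-δL * (recordSiteGeom F Mc k (recordK₀ F Mc k + n)).distD (μ0, y0) X) := mul_le_mul_of_nonneg_right (le_max_left _ _) (Real.exp_pos _).le
      _ ≤ max A C₄ * Real.exp (-(min δL δ₄) * (recordSiteGeom F Mc k (recordK₀ F Mc k + n)).distD (μ0, y0) X) := mul_le_mul_of_nonneg_left hexp (hA0.trans (le_max_left _ _))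
  · intro n X hX μ z hz
    have h4 := hR4B k ε₂₉ hε a n X hX μ z hz
    refine h4.trans ?_
    have hR0 : 0 ≤ (recordRNat F Mc k (recordK₀ F Mc k + n) : ℝ) := Nat.cast_nonneg _
    have hd0 : 0 ≤ (recordSiteGeom F Mc k (recordK₀ F Mc k + n)).distD (recordE F k (recordK₀ F Mc k + n) μ z) X := (recordSiteGeom F Mc k (recordK₀ F Mc k + n)).distD_nonneg _ X
    have hm4 : min δL δ₄ ≤ δ₄ := min_le_right _ _
    have he1 : Real.exp (-δ₄ * (recordRNat F Mc k (recordK₀ F Mc k + n) : ℝ) / 2) ≤ Real.exp (-(min δL δ₄) * (recordRNat F Mc k (recordK₀ F Mc k + n) : ℝ) / 2) :=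
      Real.exp_le_exp.2 (by nlinarith)
    have he2 : Real.exp (-(δ₄ / 2) * (recordSiteGeom F Mc k (recordK₀ F Mc k + n)).distD (recordE F k (recordK₀ F Mc k + n) μ z) X) ≤
        Real.exp (-(min δL δ₄ / 2) * (recordSiteGeom F Mc k (recordK₀ F Mc k + n)).distD (recordE F k (recordK₀ F Mc k + n) μ z) X) :=
      Real.exp_le_exp.2 (by nlinarith)
    exact mul_le_mul (mul_le_mul (le_max_right A C₄) he1 (Real.exp_pos _).le (hC4.trans (le_max_right A C₄))) he2 (Real.exp_pos _).le
      (mul_nonneg (hC4.trans (le_max_right A C₄)) (Real.exp_pos _).le)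

/-! ## §2  ★★★ The selector-free U8 package with NO displayed token -/

/-- ★★★ **THE SELECTOR-FREE U8 PACKAGE ON THE TRANSVERSE TABLE, NO DISPLAYED TOKEN**: for every guard `Mc` with `McGuard F Mc`, every `a₀` and every `α₂ > 0` there are `C₉ ≥ 0`,
`δ₀ > 0` such that for all `k`, `ε₂₉ > 0`: (C1)ᵀ for every colour `a`, `Response9DAtLocUnivξ F θ a Mc k (recordK₀ F Mc k) α₂ C₉ δ₀` (rows R0∕R1ᴰ∕R3∕R4ᴰ∕R5 of the whole-torus localized
data in the (4.4)-gauge); and for every member `n`: (C2a)(C2b)ᵀ the chart-unit localized chart `recordEmbLocξ … Finset.univ` is `C²` at `0` and vanishes there, (E4a)ᵀ its response row.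
The ‴-clauses are ✓`hL3_of_clauses34` ∘ ✓`h34_of_clause3` ∘ ✓`h3_recordHrLocξ_univ`; the two-volume NEAR comparison is the method of images (files Images 1–4c) — nothing displayed.
[cite: Balaban1985Variational, Prop. 9 p.309, (190) p.308, (137) p.298; Balaban1987RG1, (1.21) p.264, (4.4)–(4.5) pp.281–282, p.290 L17–20, (4.35) p.290; Balaban1984PropagatorsI, (1.63) p.28, Prop. 1.2 p.35, p.36 ll.20–23; Balaban1984PropagatorsII, (2.35) p.228, (2.130) p.246, (2.148)-(2.150) p.249] -/
theorem portPieceLocalityU8_LocUniv_images (Mc : ℕ) (a₀ : ℝ) (hMc : McGuard F Mc) (α₂ : ℝ) (hα₂ : 0 < α₂) :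
    ∃ C₉ δ₀ : ℝ, 0 ≤ C₉ ∧ 0 < δ₀ ∧ ∀ k : ℕ, ∀ ε₂₉ : ℝ, 0 < ε₂₉ →
      (∀ a : (thetaFill F a₀ ε₂₉).ιβ, Response9DAtLocUnivξ F (thetaFill F a₀ ε₂₉) a Mc k (recordK₀ F Mc k) α₂ C₉ δ₀) ∧
      ∀ n : ℕ, letI θ := thetaFill F a₀ ε₂₉; letI := θ.instVβ₁; letI := θ.instVβ₂;
        (ContDiffAt ℝ 2 (recordEmbLocξ F θ k (recordK₀ F Mc k + n) Finset.univ) 0 ∧ recordEmbLocξ F θ k (recordK₀ F Mc k + n) Finset.univ 0 = 0) ∧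
        ∀ a : θ.ιβ, ResponseRowAtLocξ F θ k (recordK₀ F Mc k + n) Finset.univ a := by
  obtain ⟨C₉, δ₀, hC, hδ, h⟩ := response9D_LocUniv_images F Mc a₀ hMc
    (hL3_of_clauses34 F Mc a₀ (h34_of_clause3 F Mc a₀ (h3_recordHrLocξ_univ F Mc a₀))) α₂ hα₂
  refine ⟨C₉, δ₀, hC, hδ, fun k ε₂₉ hε => ⟨fun a => ?_, fun n => ⟨?_, fun a => responseRowAtLocξ_holds F a₀ ε₂₉ k _ Finset.univ a⟩⟩⟩
  · rw [Response9DAtLocUnivξ, recordResponse9DataFromLocUnivξ_eq_update]; exact h k ε₂₉ hε a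
  · exact iotaRowAtLocξ_holds F a₀ ε₂₉ k (recordK₀ F Mc k + n) Finset.univ

end Summit.QuantumFields.YangMills.Theorems.PortU8

end
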